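import Mathlib
import Literature.NumberTheory.LFunctions.Zhang2022.SkeletonPartTwo
import HarnessLib

/-!
# Zhang (2022) §8 p. 47: the EXACT form of `S_j(𝐚₁₁,𝐚₂₁)` behind the "gathering" display
# `Z22:§8.u044` — the algebraic half of the "simple approximation", kernel-checked

Topic `Literature/NumberTheory/LFunctions/Zhang2022` (Landau–Siegel audit tree; verdict-neutral).
Y. Zhang, *Discrete mean estimates and the Landau–Siegel zero*, arXiv:2211.02515v1 (2022)
[Zhang2022LandauSiegel] — **an unrefereed manuscript under adjudication**; D-0069 campaign, cell
`siegel-zhang`, DISCHARGE lane, front end of `Skeleton.Ded823 c′`, node `Z22:§8.u044` (the display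
"Gathering these results together we conclude, by simple approximation, that
`S_j(𝐚₁₁,𝐚₂₁) = L′(1,χ)²Σ_{dr<P₂}(…)(…)(…) + L′(1,χ)²Σ_{P₂≤dr<P₁}(…) + o(α)`", tex L2436–L2442,
PDF p. 47; typed as `Section8cStatements.Step8u044 c′` / `DedStep8u044 c′`, slice L2-t8).

This file PROVES the exact identity that the display approximates (theorem `Sj_a11_a21_eq`): for a
quadratic `χ` and `log D ≥ 2`,

`S_j(𝐚₁₁,𝐚₂₁) = Σ_{n<P₂} Σ_{dr=n} w_j(d,r)·(M₁ + ι₂M₂)(N₁ + ῑ₂N₂) + Σ_{P₂≤n<P₁} Σ_{dr=n} w_j(d,r)·M₁N₁`,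

where `w_j(d,r) = |μ(r)||χ(dr)|λ₀ⱼ(dr)/(drφ(r))` (the weight `arithW` of the typed display WITHOUT
its factor `Π(d,r)`, which enters only through Lemma 8.4), and `M₁, M₂, N₁, N₂` are EXACTLY the four
sums evaluated by the four applications `Z22:§8.u040`–`Z22:§8.u043`
(`M₁ = Σ_m χ(m)ϰ₁(drm)m^{−(1−β_j)}`, `M₂` with `ϰ₂`, `N₁ = Σ_n χ(n)ϰ̄₁(drn)ξ₀ⱼ(n;d,r)/n`, `N₂` with
`ϰ̄₂`). Ingredients (all from the definitions (7.2), (8.6), (8.8) and Prop. 7.1's `S_j`):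
`𝐚₁₁(drm) = χ(dr)χ(m)(ϰ₁(drm) + ι₂ϰ₂(drm))`, `𝐚₂₁ = 𝐚̄₁₁` with `χ̄ = χ`, `χ(dr)² = |χ(dr)|`;
`ϰ₁(drm) = 0` for `dr ≥ P₁`, `ϰ₂(drm) = 0` for `dr ≥ P₂` (all `m ≥ 1`), so the `(d,r)`-term vanishes
unless `dr < P₁` and loses `M₂, N₂` unless `dr < P₂`; and the pairs `(d, r)`, `d, r < ⌈PT⁻²⌉`, with
`dr < ⌈P₁⌉` are exactly the factorisations of the `n < ⌈P₁⌉` (`P₁ ≤ PT⁻²`).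

So the content of the manuscript's "simple approximation" `Z22:§8.u044` is reduced, in the kernel,
to REPLACING `M₁, M₂, N₁, N₂` by the main terms of `Z22:§8.u040`–`u043` inside these two sums with
total error `o(α)` — which those four nodes supply only for `dr < P₁/T`, resp. `dr < P₂/T`; the
ranges `P_k/T ≤ dr < P_k` are where an additional bound (on `Σ_{n<x}|ξ₀ⱼ(n;d,r)|/n`, `x ≤ T`) is
needed (cell GAP-LEDGER row for `Z22:§8.u044`, filed with this theorem as its exact algebraic half).

WHAT THIS FILE IS NOT: a proof of `Step8u044` or of anything about the manuscript's Theorems 1–2 /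
Landau–Siegel zeros. Theorem-only; no definition, no new fact.

## References

* Y. Zhang, arXiv:2211.02515v1 (2022), §8 p. 47 (tex L2436–L2442), (8.6), (8.8), §7 Prop. 7.1
  (`S_j`), (7.2). [cite: Zhang2022LandauSiegel, §8 p.47]
-/

noncomputable section

open Complex Real ComplexConjugate Finset

namespace Literature.NumberTheory.LFunctions.Zhang2022.Section8FrontEnd44Exact

open Literature.NumberTheory.LFunctions.Zhang2022.Skeleton

/-! ## Values of a quadratic character -/

/-- A quadratic character is real-valued: `conj χ(a) = χ(a)`. [folklore] -/
private theorem conj_apply_of_quadratic {D : ℕ} [NeZero D] {χ : DirichletCharacter ℂ D}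
    (hq : χ.IsQuadratic) (a : ZMod D) : conj (χ a) = χ a := by
  rcases hq a with h | h | h <;> simp [h]

/-- For a quadratic character, `χ(a)² = |χ(a)|` (values `0, ±1`). [folklore] -/
private theorem mul_self_apply_of_quadratic {D : ℕ} [NeZero D] {χ : DirichletCharacter ℂ D}
    (hq : χ.IsQuadratic) (a : ZMod D) : χ a * χ a = (‖χ a‖ : ℂ) := by
  rcases hq a with h | h | h <;> simp [h]

/-! ## (8.8) at `drm`: `𝐚₁₁(km) = χ(k)χ(m)(ϰ₁(km) + ι₂ϰ₂(km))`, `𝐚₂₁ = 𝐚̄₁₁` -/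

/-- `𝐚₁₁(km) = χ(k)·χ(m)(ϰ₁(km) + ι₂ϰ₂(km))` ((8.8), `χ` multiplicative).
[cite: Zhang2022LandauSiegel, §8 (8.8) p.45] -/
theorem a11_mul {D : ℕ} [NeZero D] (χ : DirichletCharacter ℂ D) (k m : ℕ) :
    a11 χ (k * m) = χ (k : ZMod D) * (χ (m : ZMod D) * (vk1 D (k * m) + iota2 * vk2 D (k * m))) := by
  rw [a11, Nat.cast_mul, map_mul, mul_assoc]

/-- `𝐚₂₁(km) = χ(k)·χ(m)(ϰ̄₁(km) + ῑ₂ϰ̄₂(km))` for a quadratic `χ` ((8.8): `𝐚₂₁ = 𝐚̄₁₁`, `χ̄ = χ`).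
[cite: Zhang2022LandauSiegel, §8 (8.8) p.45] -/
theorem a21_mul {D : ℕ} [NeZero D] {χ : DirichletCharacter ℂ D} (hq : χ.IsQuadratic) (k m : ℕ) :
    a21 χ (k * m) = χ (k : ZMod D) *
      (χ (m : ZMod D) * (conj (vk1 D (k * m)) + conj iota2 * conj (vk2 D (k * m)))) := by
  rw [a21, a11_mul, map_mul, map_mul, map_add, map_mul, conj_apply_of_quadratic hq,
    conj_apply_of_quadratic hq]

/-! ## The inner sums of `S_j(𝐚₁₁,𝐚₂₁)` -/

/-- The `m`-sum of `S_j(𝐚₁₁,𝐚₂₁)` at `(d,r)`: `Σ_m 𝐚₁₁(drm)m^{−(1−β_j)} = χ(dr)(M₁ + ι₂M₂)` with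
`M₁ = Σ_m χ(m)ϰ₁(drm)m^{−(1−β_j)}`, `M₂ = Σ_m χ(m)ϰ₂(drm)m^{−(1−β_j)}` (the sums of `Z22:§8.u040/041`).
[cite: Zhang2022LandauSiegel, §8 p.47, tex L2420] -/
theorem msum_eq {D : ℕ} [NeZero D] (χ : DirichletCharacter ℂ D) (c' : ℝ) (j k : ℕ) :
    (∑ m ∈ Finset.Ico 1 (Nsupp D), a11 χ (k * m) / (m : ℂ) ^ (1 - betaJ c' D j)) =
      χ (k : ZMod D) *
        ((∑ m ∈ Finset.Ico 1 (Nsupp D),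
            χ (m : ZMod D) * vk1 D (k * m) / (m : ℂ) ^ (1 - betaJ c' D j)) +
          iota2 * ∑ m ∈ Finset.Ico 1 (Nsupp D),
            χ (m : ZMod D) * vk2 D (k * m) / (m : ℂ) ^ (1 - betaJ c' D j)) := by
  rw [Finset.mul_sum, mul_add, Finset.mul_sum, Finset.mul_sum, ← Finset.sum_add_distrib]
  apply Finset.sum_congr rfl
  intro m _
  rw [a11_mul]
  ring

/-- The `n`-sum of `S_j(𝐚₁₁,𝐚₂₁)` at `(d,r)`: `Σ_n 𝐚₂₁(drn)ξ₀ⱼ(n;d,r)/n = χ(dr)(N₁ + ῑ₂N₂)` with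
`N₁ = Σ_n χ(n)ϰ̄₁(drn)ξ₀ⱼ(n;d,r)/n`, `N₂ = Σ_n χ(n)ϰ̄₂(drn)ξ₀ⱼ(n;d,r)/n` (the sums of `Z22:§8.u042/043`).
[cite: Zhang2022LandauSiegel, §8 p.47, tex L2428] -/
theorem nsum_eq {D : ℕ} [NeZero D] {χ : DirichletCharacter ℂ D} (hq : χ.IsQuadratic) (c' : ℝ)
    (j d r : ℕ) :
    (∑ n ∈ Finset.Ico 1 (Nsupp D), a21 χ (d * r * n) * xiZero c' D j n d r / (n : ℂ)) =
      χ ((d * r : ℕ) : ZMod D) *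
        ((∑ n ∈ Finset.Ico 1 (Nsupp D),
            χ (n : ZMod D) * conj (vk1 D (d * r * n)) * xiZero c' D j n d r / (n : ℂ)) +
          conj iota2 * ∑ n ∈ Finset.Ico 1 (Nsupp D),
            χ (n : ZMod D) * conj (vk2 D (d * r * n)) * xiZero c' D j n d r / (n : ℂ)) := by
  rw [Finset.mul_sum, mul_add, Finset.mul_sum, Finset.mul_sum, ← Finset.sum_add_distrib]
  apply Finset.sum_congr rfl
  intro n _
  rw [a21_mul hq]
  push_cast
  ring

/-! ## Supports: `ϰ₁(drm) = 0` for `dr ≥ P₁`, `ϰ₂(drm) = 0` for `dr ≥ P₂` -/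

/-- `ϰ₁(km) = 0` for `k ≥ P₁`, `m ≥ 1` ((8.6)). [cite: Zhang2022LandauSiegel, §8 (8.6) p.45] -/
theorem vk1_eq_zero_of_le {D k m : ℕ} (hk : Skeleton.P1 D ≤ k) (hm : 1 ≤ m) : vk1 D (k * m) = 0 := by
  have : Skeleton.P1 D ≤ ((k * m : ℕ) : ℝ) := by
    have h1 : (k : ℝ) ≤ ((k * m : ℕ) : ℝ) := by exact_mod_cast Nat.le_mul_of_pos_right k hm
    linarith
  rw [vk1, if_neg (not_lt.mpr this)]

/-- `ϰ₂(km) = 0` for `k ≥ P₂`, `m ≥ 1` ((8.6)). [cite: Zhang2022LandauSiegel, §8 (8.6) p.45] -/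
theorem vk2_eq_zero_of_le {D k m : ℕ} (hk : Skeleton.P2 D ≤ k) (hm : 1 ≤ m) : vk2 D (k * m) = 0 := by
  have : Skeleton.P2 D ≤ ((k * m : ℕ) : ℝ) := by
    have h1 : (k : ℝ) ≤ ((k * m : ℕ) : ℝ) := by exact_mod_cast Nat.le_mul_of_pos_right k hm
    linarith
  rw [vk2, if_neg (not_lt.mpr this)]

/-! ## Re-indexing the double sum over `(d, r)` by `n = dr` -/

/-- The pairs `(d,r)` with `1 ≤ d, r < N` and `dr < K ≤ N` are the factorisations of the `n`,
`1 ≤ n < K`. [folklore] -/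
private theorem filter_product_eq_biUnion {N K : ℕ} (hKN : K ≤ N) :
    (Finset.Ico 1 N ×ˢ Finset.Ico 1 N).filter (fun p : ℕ × ℕ => p.1 * p.2 < K) =
      (Finset.Ico 1 K).biUnion Nat.divisorsAntidiagonal := by
  ext p
  simp only [Finset.mem_filter, Finset.mem_product, Finset.mem_Ico, Finset.mem_biUnion,
    Nat.mem_divisorsAntidiagonal]
  constructor
  · rintro ⟨⟨⟨h1, -⟩, ⟨h2, -⟩⟩, hK⟩
    refine ⟨p.1 * p.2, ⟨Nat.one_le_iff_ne_zero.mpr (Nat.mul_ne_zero (by omega) (by omega)), hK⟩,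
      rfl, Nat.mul_ne_zero (by omega) (by omega)⟩
  · rintro ⟨n, ⟨hn1, hnK⟩, hpn, hn0⟩
    have hp1 : p.1 ≠ 0 := fun h => hn0 (by rw [← hpn, h, zero_mul])
    have hp2 : p.2 ≠ 0 := fun h => hn0 (by rw [← hpn, h, mul_zero])
    have h1 : p.1 ≤ n := by rw [← hpn]; exact Nat.le_mul_of_pos_right _ (Nat.pos_of_ne_zero hp2)
    have h2 : p.2 ≤ n := by rw [← hpn]; exact Nat.le_mul_of_pos_left _ (Nat.pos_of_ne_zero hp1)
    refine ⟨⟨⟨Nat.one_le_iff_ne_zero.mpr hp1, by omega⟩, ⟨Nat.one_le_iff_ne_zero.mpr hp2, by omega⟩⟩,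
      by rw [hpn]; exact hnK⟩

/-- Distinct `n` have disjoint divisor antidiagonals. [folklore] -/
private theorem pairwiseDisjoint_divisorsAntidiagonal (s : Finset ℕ) :
    (s : Set ℕ).PairwiseDisjoint Nat.divisorsAntidiagonal := by
  intro a _ b _ hab
  rw [Function.onFun, Finset.disjoint_left]
  intro p ha hb
  rw [Nat.mem_divisorsAntidiagonal] at ha hb
  exact hab (ha.1.symm.trans hb.1)

/-- Re-indexing: a double sum over `1 ≤ d, r < N` whose terms vanish for `dr ≥ K` (`K ≤ N`) is the
sum over `1 ≤ n < K` of the sums over the factorisations `n = dr`. [folklore] -/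
private theorem sum_sum_eq_sum_antidiagonal {N K : ℕ} (hKN : K ≤ N) (f : ℕ → ℕ → ℂ)
    (hf : ∀ d r : ℕ, 1 ≤ d → 1 ≤ r → K ≤ d * r → f d r = 0) :
    (∑ d ∈ Finset.Ico 1 N, ∑ r ∈ Finset.Ico 1 N, f d r) =
      ∑ n ∈ Finset.Ico 1 K, ∑ p ∈ Nat.divisorsAntidiagonal n, f p.1 p.2 := by
  rw [← Finset.sum_product', ← Finset.sum_biUnion (pairwiseDisjoint_divisorsAntidiagonal _),
    ← filter_product_eq_biUnion hKN, Finset.sum_filter]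
  apply Finset.sum_congr rfl
  intro p hp
  rw [Finset.mem_product, Finset.mem_Ico, Finset.mem_Ico] at hp
  by_cases h : p.1 * p.2 < K
  · rw [if_pos h]
  · rw [if_neg h, hf p.1 p.2 hp.1.1 hp.2.1 (not_lt.mp h)]

/-! ## The exact identity -/

/-- **The exact form of `S_j(𝐚₁₁,𝐚₂₁)` behind `Z22:§8.u044`**: for a quadratic `χ` and `log D ≥ 2`,
`S_j(𝐚₁₁,𝐚₂₁) = Σ_{1≤n<⌈P₂⌉} Σ_{dr=n} w_j(d,r)(M₁+ι₂M₂)(N₁+ῑ₂N₂) + Σ_{⌈P₂⌉≤n<⌈P₁⌉} Σ_{dr=n} w_j(d,r)M₁N₁`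
with `w_j(d,r) = |μ(r)||χ(dr)|λ₀ⱼ(dr)/(drφ(r))` and `M₁, M₂, N₁, N₂` the four sums of
`Z22:§8.u040`–`Z22:§8.u043` at `(d,r)` — an IDENTITY (no error term): the "simple approximation" of the
manuscript is exactly the replacement of `M_k, N_k` by their main terms inside these sums.
[cite: Zhang2022LandauSiegel, §8 display before (8.10) p.47, tex L2436] -/
theorem Sj_a11_a21_eq (c' : ℝ) {D : ℕ} [NeZero D] {χ : DirichletCharacter ℂ D}
    (hq : χ.IsQuadratic) (hP1 : Skeleton.P1 D ≤ bigP D / bigT D ^ 2)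
    (hP21 : Skeleton.P2 D ≤ Skeleton.P1 D) (j : ℕ) :
    Sj c' D j (a11 χ) (a21 χ) =
      (∑ n ∈ Finset.Ico 1 ⌈Skeleton.P2 D⌉₊, ∑ p ∈ Nat.divisorsAntidiagonal n,
        ((ArithmeticFunction.moebius p.2).natAbs : ℂ) * (‖χ ((p.1 * p.2 : ℕ) : ZMod D)‖ : ℂ) /
              (((p.1 * p.2 : ℕ) : ℂ) * (Nat.totient p.2 : ℂ)) * lamZero c' D j (p.1 * p.2) *
          (((∑ m ∈ Finset.Ico 1 (Nsupp D),
                χ (m : ZMod D) * vk1 D (p.1 * p.2 * m) / (m : ℂ) ^ (1 - betaJ c' D j)) +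
              iota2 * ∑ m ∈ Finset.Ico 1 (Nsupp D),
                χ (m : ZMod D) * vk2 D (p.1 * p.2 * m) / (m : ℂ) ^ (1 - betaJ c' D j)) *
            ((∑ n ∈ Finset.Ico 1 (Nsupp D),
                χ (n : ZMod D) * conj (vk1 D (p.1 * p.2 * n)) * xiZero c' D j n p.1 p.2 / (n : ℂ)) +
              conj iota2 * ∑ n ∈ Finset.Ico 1 (Nsupp D),
                χ (n : ZMod D) * conj (vk2 D (p.1 * p.2 * n)) * xiZero c' D j n p.1 p.2 /
                  (n : ℂ)))) +
      ∑ n ∈ Finset.Ico ⌈Skeleton.P2 D⌉₊ ⌈Skeleton.P1 D⌉₊, ∑ p ∈ Nat.divisorsAntidiagonal n,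
        ((ArithmeticFunction.moebius p.2).natAbs : ℂ) * (‖χ ((p.1 * p.2 : ℕ) : ZMod D)‖ : ℂ) /
              (((p.1 * p.2 : ℕ) : ℂ) * (Nat.totient p.2 : ℂ)) * lamZero c' D j (p.1 * p.2) *
          ((∑ m ∈ Finset.Ico 1 (Nsupp D),
              χ (m : ZMod D) * vk1 D (p.1 * p.2 * m) / (m : ℂ) ^ (1 - betaJ c' D j)) *
            (∑ n ∈ Finset.Ico 1 (Nsupp D),
              χ (n : ZMod D) * conj (vk1 D (p.1 * p.2 * n)) * xiZero c' D j n p.1 p.2 / (n : ℂ))) := by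
  -- abbreviations
  set N := Nsupp D with hN
  set M₁ : ℕ → ℕ → ℂ := fun d r => ∑ m ∈ Finset.Ico 1 N,
    χ (m : ZMod D) * vk1 D (d * r * m) / (m : ℂ) ^ (1 - betaJ c' D j) with hM₁
  set M₂ : ℕ → ℕ → ℂ := fun d r => ∑ m ∈ Finset.Ico 1 N,
    χ (m : ZMod D) * vk2 D (d * r * m) / (m : ℂ) ^ (1 - betaJ c' D j) with hM₂
  set N₁ : ℕ → ℕ → ℂ := fun d r => ∑ n ∈ Finset.Ico 1 N,
    χ (n : ZMod D) * conj (vk1 D (d * r * n)) * xiZero c' D j n d r / (n : ℂ) with hN₁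
  set N₂ : ℕ → ℕ → ℂ := fun d r => ∑ n ∈ Finset.Ico 1 N,
    χ (n : ZMod D) * conj (vk2 D (d * r * n)) * xiZero c' D j n d r / (n : ℂ) with hN₂
  set w : ℕ → ℕ → ℂ := fun d r =>
    ((ArithmeticFunction.moebius r).natAbs : ℂ) * (‖χ ((d * r : ℕ) : ZMod D)‖ : ℂ) /
      (((d * r : ℕ) : ℂ) * (Nat.totient r : ℂ)) * lamZero c' D j (d * r) with hw
  -- Step 1: the (d,r)-term of `S_j` is `w(d,r)(M₁+ι₂M₂)(N₁+ῑ₂N₂)`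
  have hterm : ∀ d r : ℕ,
      ((ArithmeticFunction.moebius r).natAbs : ℂ) * lamZero c' D j (d * r) /
            ((d * r : ℕ) * (Nat.totient r : ℂ)) *
          (∑ m ∈ Finset.Ico 1 N, a11 χ (d * r * m) / (m : ℂ) ^ (1 - betaJ c' D j)) *
          (∑ n ∈ Finset.Ico 1 N, a21 χ (d * r * n) * xiZero c' D j n d r / (n : ℂ)) =
        w d r * ((M₁ d r + iota2 * M₂ d r) * (N₁ d r + conj iota2 * N₂ d r)) := by
    intro d r
    rw [hN, msum_eq χ c' j (d * r), nsum_eq hq c' j d r, ← hN]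
    simp only [hw, hM₁, hM₂, hN₁, hN₂]
    have hsq := mul_self_apply_of_quadratic hq ((d * r : ℕ) : ZMod D)
    rw [← hsq]
    ring
  -- Step 2: supports
  have hM₁0 : ∀ d r : ℕ, Skeleton.P1 D ≤ ((d * r : ℕ) : ℝ) → M₁ d r = 0 := by
    intro d r h
    simp only [hM₁]
    apply Finset.sum_eq_zero
    intro m hm
    rw [Finset.mem_Ico] at hm
    rw [vk1_eq_zero_of_le h hm.1, mul_zero, zero_div]
  have hM₂0 : ∀ d r : ℕ, Skeleton.P2 D ≤ ((d * r : ℕ) : ℝ) → M₂ d r = 0 := by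
    intro d r h
    simp only [hM₂]
    apply Finset.sum_eq_zero
    intro m hm
    rw [Finset.mem_Ico] at hm
    rw [vk2_eq_zero_of_le h hm.1, mul_zero, zero_div]
  have hN₂0 : ∀ d r : ℕ, Skeleton.P2 D ≤ ((d * r : ℕ) : ℝ) → N₂ d r = 0 := by
    intro d r h
    simp only [hN₂]
    apply Finset.sum_eq_zero
    intro n hn
    rw [Finset.mem_Ico] at hn
    rw [vk2_eq_zero_of_le h hn.1, map_zero, mul_zero, zero_mul, zero_div]
  -- Step 3: re-index by `n = dr` over `n < ⌈P₁⌉`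
  have hK : ⌈Skeleton.P1 D⌉₊ ≤ N := by rw [hN, Nsupp]; exact Nat.ceil_mono hP1
  have step3 : Sj c' D j (a11 χ) (a21 χ) =
      ∑ n ∈ Finset.Ico 1 ⌈Skeleton.P1 D⌉₊, ∑ p ∈ Nat.divisorsAntidiagonal n,
        w p.1 p.2 * ((M₁ p.1 p.2 + iota2 * M₂ p.1 p.2) * (N₁ p.1 p.2 + conj iota2 * N₂ p.1 p.2)) := by
    rw [Sj, ← hN]
    rw [← sum_sum_eq_sum_antidiagonal hK (fun d r =>
        w d r * ((M₁ d r + iota2 * M₂ d r) * (N₁ d r + conj iota2 * N₂ d r)))]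
    · apply Finset.sum_congr rfl
      intro d _
      apply Finset.sum_congr rfl
      intro r _
      exact hterm d r
    · intro d r _ _ hK'
      have h1 : Skeleton.P1 D ≤ ((d * r : ℕ) : ℝ) := le_trans (Nat.le_ceil _) (by exact_mod_cast hK')
      have h2 : Skeleton.P2 D ≤ ((d * r : ℕ) : ℝ) := le_trans hP21 h1
      rw [hM₁0 d r h1, hM₂0 d r h2, zero_add, mul_zero, zero_mul, mul_zero]
  -- Step 4: split the range at `⌈P₂⌉` and drop `M₂, N₂` on the upper part
  have hsplit : ⌈Skeleton.P2 D⌉₊ ≤ ⌈Skeleton.P1 D⌉₊ := Nat.ceil_mono hP21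
  have hP2pos : 0 < Skeleton.P2 D :=
    div_pos (Real.rpow_pos_of_pos (Real.exp_pos _) _) (pow_pos (Real.exp_pos _) _)
  have h1le : 1 ≤ ⌈Skeleton.P2 D⌉₊ := Nat.one_le_iff_ne_zero.mpr (Nat.ceil_pos.mpr hP2pos).ne'
  rw [step3, ← Finset.sum_Ico_consecutive _ h1le hsplit]
  congr 1
  apply Finset.sum_congr rfl
  intro n hn
  rw [Finset.mem_Ico] at hn
  apply Finset.sum_congr rfl
  intro p hp
  rw [Nat.mem_divisorsAntidiagonal] at hp
  have h2 : Skeleton.P2 D ≤ ((p.1 * p.2 : ℕ) : ℝ) := by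
    rw [hp.1]; exact le_trans (Nat.le_ceil _) (by exact_mod_cast hn.1)
  rw [hM₂0 p.1 p.2 h2, hN₂0 p.1 p.2 h2, mul_zero, add_zero, mul_zero, add_zero]

end Literature.NumberTheory.LFunctions.Zhang2022.Section8FrontEnd44Exact
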